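import Literature.Geometry.Kaehler.ManifoldFormsChart
import Literature.Geometry.Manifold.CompactChartDomainEmbedding

/-!
# Line `stable-seam-host` (crux `OrigamiFoldExistence`, stmt-SmoothPoincare4-7844): brick B4, the chart representative of a symplectic form

Wave 2 of lead c10, registered helper `helper_inChart_symplectic_package` (brick B4 of the
design "SR holds at every seam that bounds a smoothly embedded ball").  For a symplectic
`MForm` `Ω` (smooth, closed, nondegenerate 2-form) on an `ℝ⁴`-charted `C^∞` manifold `X` and a
point `x₀`, with `e = extChartAt (𝓡 4) x₀` and `Ωc = Ω.inChart x₀ : ℝ⁴ → ℝ⁴ [⋀^Fin 2]→L[ℝ] ℝ`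
the chart representative, this file proves the dictionary between `Ω` and `Ωc`:

1. `Ωc` is `C^∞` on `e.target` (tree: `IsSmoothForm.contDiffOn_inChart`, Lee 2013, Lemma 14.16);
2. `d Ωc = 0` on `e.target` (whole-chart formula `inChart_mextDeriv_of_mem_target`,
   Warner 1983, Prop. 2.23, and `dΩ = 0`);
3. `Ωc` is nondegenerate on `e.target` (from 4. and the bijectivity of `d(e.symm)` on the
   target, `Literature.Geometry.Manifold.bijective_mfderiv_extChartAt_symm`);
4. `Ω (e.symm y) (d(e.symm)_y v, d(e.symm)_y w) = Ωc y (v, w)` (the definition of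
   `MForm.inChart`, the model `𝓡 4` being boundaryless so that `mfderivWithin … (range (𝓡 4))`
   is `mfderiv`).

No definitions, no named facts, no `sorry`.
-/

noncomputable section

-- the prescribed namespace `Summit.<P>.<Sub>.…` duplicates `SmoothPoincare4` (P = Sub)
set_option linter.dupNamespace false

open scoped Manifold ContDiff Topology
open Set Function

namespace Summit.SmoothPoincare4.SmoothPoincare4.Theorems.OrigamiFoldExistence.StableSeamHost

open Literature.Geometry.Kaehler

/-- **The chart representative evaluates the form on push-forwards of the inverse chart**
(boundaryless model `𝓡 4`: the `mfderivWithin … (range (𝓡 4))` of `MForm.inChart` is the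
plain `mfderiv`). [folklore] -/
theorem apply_symm_mfderiv_eq_inChart {X : Type*} [TopologicalSpace X]
    [ChartedSpace (EuclideanSpace ℝ (Fin 4)) X] (Ω : MForm (𝓡 4) X ℝ 2) (x₀ : X)
    (y : EuclideanSpace ℝ (Fin 4)) (v w : EuclideanSpace ℝ (Fin 4)) :
    Ω ((extChartAt (𝓡 4) x₀).symm y)
        ![mfderiv (𝓡 4) (𝓡 4) (extChartAt (𝓡 4) x₀).symm y v,
          mfderiv (𝓡 4) (𝓡 4) (extChartAt (𝓡 4) x₀).symm y w] =
      Ω.inChart x₀ y ![v, w] := by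
  rw [MForm.inChart_apply]
  simp only [ModelWithCorners.Boundaryless.range_eq_univ, mfderivWithin_univ]
  congr 1
  funext i
  fin_cases i <;> rfl

/-- **A smooth closed form has closed chart representatives** on the whole chart target:
`d (Ω.inChart x₀) y = 0` for `y ∈ e.target` (whole-chart formula for `d`,
`inChart_mextDeriv_of_mem_target`, Warner 1983, Prop. 2.23, and `dΩ = 0`).
[cite: WarnerGTM94, Prop. 2.23] -/
theorem extDeriv_inChart_eq_zero_of_isClosedForm {X : Type*} [TopologicalSpace X]
    [ChartedSpace (EuclideanSpace ℝ (Fin 4)) X] [IsManifold (𝓡 4) ∞ X] {k : ℕ}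
    {Ω : MForm (𝓡 4) X ℝ k} (hΩs : IsSmoothForm Ω) (hΩc : IsClosedForm Ω) {x₀ : X}
    {y : EuclideanSpace ℝ (Fin 4)} (hy : y ∈ (extChartAt (𝓡 4) x₀).target) :
    extDeriv (Ω.inChart x₀) y = 0 := by
  have h := inChart_mextDeriv_of_mem_target Ω hy (hΩs _)
  have h0 : mextDeriv Ω = 0 := hΩc
  rw [h0, MForm.inChart_zero, ModelWithCorners.Boundaryless.range_eq_univ, extDerivWithin_univ] at h
  exact h.symm

/-- **B4: the chart representative of a symplectic `MForm`.**  For a symplectic form `Ω`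
(smooth, closed, nondegenerate) on the `ℝ⁴`-charted `X` and a point `x₀`, the representative
`Ω.inChart x₀` is `C^∞`, closed and nondegenerate on the target of the extended chart `e` at
`x₀`, and `Ω (e.symm y) (d(e.symm)_y v, d(e.symm)_y w) = Ω.inChart x₀ y (v, w)` there
(Lee 2013, Lemma 14.16; Warner 1983, Prop. 2.23; nondegeneracy transported along the bijective
differential of `e.symm`). [folklore] -/
theorem helper_inChart_symplectic_package : ∀ (X : Type) [TopologicalSpace X] [ChartedSpace (EuclideanSpace ℝ (Fin 4)) X] [IsManifold (𝓡 4) ∞ X] (Ω : Literature.Geometry.Kaehler.MForm (𝓡 4) X ℝ 2), (Literature.Geometry.Kaehler.IsSmoothForm Ω ∧ Literature.Geometry.Kaehler.IsClosedForm Ω ∧ ∀ x (v : TangentSpace (𝓡 4) x), v ≠ 0 → ∃ w, Ω x ![v, w] ≠ 0) → ∀ x₀ : X, ContDiffOn ℝ ∞ (Ω.inChart x₀) (extChartAt (𝓡 4) x₀).target ∧ (∀ y ∈ (extChartAt (𝓡 4) x₀).target, extDeriv (Ω.inChart x₀) y = 0) ∧ (∀ y ∈ (extChartAt (𝓡 4)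 x₀).target, ∀ v : EuclideanSpace ℝ (Fin 4), v ≠ 0 → ∃ w, Ω.inChart x₀ y ![v, w] ≠ 0) ∧ (∀ y ∈ (extChartAt (𝓡 4) x₀).target, ∀ v w : EuclideanSpace ℝ (Fin 4), Ω ((extChartAt (𝓡 4) x₀).symm y) ![mfderiv (𝓡 4) (𝓡 4) (extChartAt (𝓡 4) x₀).symm y v, mfderiv (𝓡 4) (𝓡 4) (extChartAt (𝓡 4) x₀).symm y w] = Ω.inChart x₀ y ![v, w]) := by
  intro X _ _ _ Ω hΩ x₀
  obtain ⟨hΩs, hΩc, hΩn⟩ := hΩ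
  refine ⟨hΩs.contDiffOn_inChart x₀,
    fun y hy => extDeriv_inChart_eq_zero_of_isClosedForm hΩs hΩc hy,
    fun y hy v hv => ?_, fun y _ v w => apply_symm_mfderiv_eq_inChart Ω x₀ y v w⟩
  have hbij := Literature.Geometry.Manifold.bijective_mfderiv_extChartAt_symm (M := X) hy
  have hv' : mfderiv (𝓡 4) (𝓡 4) (extChartAt (𝓡 4) x₀).symm y v ≠ 0 := fun h =>
    hv (hbij.1 (h.trans (map_zero _).symm))
  obtain ⟨w', hw'⟩ := hΩn _ _ hv'
  obtain ⟨w, rfl⟩ := hbij.2 w'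
  exact ⟨w, by rw [← apply_symm_mfderiv_eq_inChart Ω x₀ y v w]; exact hw'⟩

end Summit.SmoothPoincare4.SmoothPoincare4.Theorems.OrigamiFoldExistence.StableSeamHost

end
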